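import Mathlib
import HarnessLib
import Literature.NumberTheory.LFunctions.VinogradovMeanValueCount
import Literature.NumberTheory.LFunctions.VinogradovTorus

/-!
# Vinogradov's mean value theorem, III: the `p`-adic decomposition (Ivić, proof of Lemma 6.2, A)

Topic `Literature/NumberTheory/LFunctions`. Everything in this file is PROVED (no named facts).

Set-up of the proof of Ivić's Lemma 6.2 (the recurrent inequality for `J_{k,n}(P)`): for a prime
`p` and `P₁ ≥ 1` every `X ∈ [1, pP₁]` is written uniquely as `X = x + py`, `1 ≤ x ≤ p`,
`0 ≤ y < P₁` ("digits"), the generating function splits as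
`f(α) = ∑_{X ≤ pP₁} e(α·ν(X)) = ∑_{x ≤ p} S_x(α)`, `S_x(α) = ∑_{y < P₁} e(α·ν(x + py))`
(`ν(X) = (X, X², …, Xⁿ)`), and

* `integral_norm_Sx_pow` — `∫ |S_x|^{2k} = J_{k,n}([0, P₁))` (translation–dilation invariance);
* `card_sol_deg_le` — the **second class** (Ivić's `J₂`): the number of solutions `(X, Y)` of the
  system in `[1, pP₁]^{2k}` in which the digits `x_1, …, x_k` of `X` take fewer than `n` distinct
  values is at most `#{degenerate digit patterns} · p^k · J_{k,n}([0,P₁))`, by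
  `|∏_{i} S_{x_i} ∏_i S_{x'_i}| ≤ (2k)⁻¹ ∑ |S|^{2k}` (AM–GM; Ivić uses Hölder) and the previous item;
* `card_degPat_le` — there are at most `p^{n-1} n^k` degenerate digit patterns.

The first class (distinct digits, Linnik's lemma) is treated in the next file.

## References

* A. Ivić, *The Riemann Zeta-Function*, Wiley 1985, §6.2, proof of Lemma 6.2 (pp. 149–151).
-/

noncomputable section

open Finset MeasureTheory Complex
open scoped Real ComplexConjugate

namespace Literature.NumberTheory.LFunctions
namespace VMV

/-! ### The curve `ν(X) = (X, …, Xⁿ)` and the digit decomposition of `[1, pP₁]` -/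

/-- `ν(X) = (X^j)_{j=1..n}`. [cite: Ivic1985, (6.5)] -/
def nu (n : ℕ) (x : ℤ) : Fin n → ℤ := fun j => x ^ (j.val + 1)

/-- `s(X) = ∑_i ν(X_i)`: the power-sum vector is the sum of the curve points. [folklore] -/
theorem psv_eq_sum_nu (n : ℕ) {k : ℕ} (X : Fin k → ℤ) : psv n X = ∑ i, nu n (X i) := by
  funext j; simp [psv, nu, Finset.sum_apply]

/-- `Y = [0, P₁)`, the range of the high digit. [folklore] -/
def Yset (P₁ : ℕ) : Finset ℤ := Finset.Ico (0 : ℤ) P₁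

/-- `[1, pP₁]`. [folklore] -/
def IQ (p P₁ : ℕ) : Finset ℤ := Finset.Icc (1 : ℤ) ((p : ℤ) * P₁)

/-- The digits `[1, p]`. [folklore] -/
def Dig (p : ℕ) : Finset ℤ := Finset.Icc (1 : ℤ) p

/-- `#[0, P₁) = P₁`. [folklore] -/
theorem card_Yset (P₁ : ℕ) : (Yset P₁).card = P₁ := by simp [Yset]

/-- `#[1, p] = p`. [folklore] -/
theorem card_Dig (p : ℕ) : (Dig p).card = p := by simp [Dig]

/-- The low digit `x = ((X − 1) mod p) + 1 ∈ [1, p]`. [folklore] -/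
def digit (p : ℕ) (X : ℤ) : ℤ := (X - 1) % p + 1

/-- The high digit `y = ⌊(X − 1)/p⌋`. [folklore] -/
def hdigit (p : ℕ) (X : ℤ) : ℤ := (X - 1) / p

/-- `X = x + p y` for the digits `x, y` of `X`. [folklore] -/
theorem digit_add_mul_hdigit (p : ℕ) (X : ℤ) : digit p X + p * hdigit p X = X := by
  unfold digit hdigit
  have := Int.emod_add_mul_ediv (X - 1) p
  linarith

/-- The low digit lies in `[1, p]`. [folklore] -/
theorem digit_mem_Dig {p : ℕ} (hp : 0 < p) (X : ℤ) : digit p X ∈ Dig p := by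
  unfold digit Dig
  have hp' : (0 : ℤ) < p := by exact_mod_cast hp
  rw [Finset.mem_Icc]
  constructor
  · linarith [Int.emod_nonneg (X - 1) hp'.ne']
  · linarith [Int.emod_lt_of_pos (X - 1) hp']

/-- The high digit of `X ∈ [1, pP₁]` lies in `[0, P₁)`. [folklore] -/
theorem hdigit_mem_Yset {p P₁ : ℕ} (hp : 0 < p) {X : ℤ} (hX : X ∈ IQ p P₁) : hdigit p X ∈ Yset P₁ := by
  unfold hdigit Yset
  rw [IQ, Finset.mem_Icc] at hX
  have hp' : (0 : ℤ) < p := by exact_mod_cast hp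
  rw [Finset.mem_Ico]
  constructor
  · exact Int.ediv_nonneg (by linarith) hp'.le
  · exact Int.ediv_lt_of_lt_mul hp' (by linarith)

/-- `x + py ∈ [1, pP₁]` for `x ∈ [1,p]`, `y ∈ [0,P₁)`. [folklore] -/
theorem combine_mem_IQ {p P₁ : ℕ} {x y : ℤ} (hx : x ∈ Dig p) (hy : y ∈ Yset P₁) :
    x + p * y ∈ IQ p P₁ := by
  rw [Dig, Finset.mem_Icc] at hx
  rw [Yset, Finset.mem_Ico] at hy
  rw [IQ, Finset.mem_Icc]
  have hp0 : (0 : ℤ) ≤ p := by positivity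
  constructor
  · nlinarith
  · have : y ≤ (P₁ : ℤ) - 1 := by linarith
    nlinarith

/-- The low digit of `x + py` is `x` (`x ∈ [1,p]`). [folklore] -/
theorem digit_combine {p : ℕ} {x : ℤ} (hx : x ∈ Dig p) (y : ℤ) : digit p (x + p * y) = x := by
  rw [Dig, Finset.mem_Icc] at hx
  unfold digit
  rw [show x + p * y - 1 = (x - 1) + (p : ℤ) * y by ring, Int.add_mul_emod_self_left,
    Int.emod_eq_of_lt (by linarith) (by linarith)]
  ring

/-- The high digit of `x + py` is `y` (`x ∈ [1,p]`). [folklore] -/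
theorem hdigit_combine {p : ℕ} {x : ℤ} (hx : x ∈ Dig p) (y : ℤ) : hdigit p (x + p * y) = y := by
  rw [Dig, Finset.mem_Icc] at hx
  unfold hdigit
  have hp : (p : ℤ) ≠ 0 := by intro h; rw [h] at hx; linarith
  rw [show x + p * y - 1 = (x - 1) + y * (p : ℤ) by ring, Int.add_mul_ediv_right _ _ hp,
    Int.ediv_eq_zero_of_lt (by linarith) (by linarith), zero_add]

/-- `digit X = digit X'` iff `X ≡ X' (mod p)`. [folklore] -/
theorem digit_eq_digit_iff {p : ℕ} (X X' : ℤ) : digit p X = digit p X' ↔ (p : ℤ) ∣ X - X' := by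
  unfold digit
  rw [add_left_inj, Int.emod_emod_of_dvd _ (dvd_refl _) |>.symm.trans (Int.emod_emod_of_dvd _ (dvd_refl _)),
    Int.emod_eq_emod_iff_emod_sub_eq_zero, ← Int.dvd_iff_emod_eq_zero, show X - 1 - (X' - 1) = X - X' by ring]

/-! ### Reindexing sums over `[1, pP₁]^k` by digits -/

/-- Sums over tuples `X ∈ [1, pP₁]^k`, restricted by a condition on the low digits, reindexed by
the digit tuples `(x, y) ∈ [1,p]^k × [0,P₁)^k`, `X_i = x_i + p y_i`. [folklore] -/
theorem sum_tuples_IQ_eq {p P₁ k : ℕ} (hp : 0 < p) {M : Type*} [AddCommMonoid M]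
    (F : (Fin k → ℤ) → M) (Pd : (Fin k → ℤ) → Prop) [DecidablePred Pd] :
    ∑ X ∈ (tuples k (IQ p P₁)).filter (fun X => Pd (fun i => digit p (X i))), F X =
      ∑ xy ∈ ((tuples k (Dig p)).filter Pd) ×ˢ tuples k (Yset P₁),
        F (fun i => xy.1 i + p * xy.2 i) := by
  refine Finset.sum_nbij' (fun X => (fun i => digit p (X i), fun i => hdigit p (X i)))
    (fun xy => fun i => xy.1 i + p * xy.2 i) ?_ ?_ ?_ ?_ ?_
  · intro X hX
    rw [mem_filter, mem_tuples] at hX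
    rw [mem_product, mem_filter, mem_tuples, mem_tuples]
    exact ⟨⟨fun i => digit_mem_Dig hp _, hX.2⟩, fun i => hdigit_mem_Yset hp (hX.1 i)⟩
  · intro xy hxy
    rw [mem_product, mem_filter, mem_tuples, mem_tuples] at hxy
    rw [mem_filter, mem_tuples]
    refine ⟨fun i => combine_mem_IQ (hxy.1.1 i) (hxy.2 i), ?_⟩
    simp only [digit_combine (hxy.1.1 _)]
    exact hxy.1.2
  · intro X _
    funext i
    exact digit_add_mul_hdigit p (X i)
  · intro xy hxy
    rw [mem_product, mem_filter, mem_tuples, mem_tuples] at hxy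
    ext i
    · exact digit_combine (hxy.1.1 i) _
    · exact hdigit_combine (hxy.1.1 i) _
  · intro X _
    simp only [digit_add_mul_hdigit]

/-! ### `S_x` and the splitting `f = ∑_x S_x` -/

/-- `S_x(α) = ∑_{0 ≤ y < P₁} e(α · ν(x + py))` (Ivić's `S(x)`, p. 149). [cite: Ivic1985, p. 149] -/
def Sx (n p P₁ : ℕ) (x : ℤ) (α : Fin n → ℝ) : ℂ := tp (Yset P₁) (fun y => nu n (x + p * y)) α

/-- `f(α) = ∑_{1 ≤ X ≤ pP₁} e(α · ν(X))`. [cite: Ivic1985, (6.5)] -/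
def fQ (n p P₁ : ℕ) (α : Fin n → ℝ) : ℂ := tp (IQ p P₁) (nu n) α

/-- `S_x` is continuous in `α`. [folklore] -/
theorem continuous_Sx (n p P₁ : ℕ) (x : ℤ) : Continuous (Sx n p P₁ x) := continuous_tp _ _

/-- **`f = ∑_{x ≤ p} S_x`** (Ivić p. 149: the splitting of the generating function by the residue of the variable). [folklore] -/
theorem fQ_eq_sum_Sx {n p P₁ : ℕ} (hp : 0 < p) (α : Fin n → ℝ) :
    fQ n p P₁ α = ∑ x ∈ Dig p, Sx n p P₁ x α := by
  unfold fQ Sx tp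
  rw [← sum_product (s := Dig p) (t := Yset P₁) (f := fun xy => E (nu n (xy.1 + p * xy.2)) α)]
  refine Finset.sum_nbij' (fun X => (digit p X, hdigit p X)) (fun xy => xy.1 + p * xy.2) ?_ ?_ ?_ ?_ ?_
  · intro X hX
    exact mem_product.2 ⟨digit_mem_Dig hp _, hdigit_mem_Yset hp hX⟩
  · intro xy hxy
    rw [mem_product] at hxy
    exact combine_mem_IQ hxy.1 hxy.2
  · intro X _; exact digit_add_mul_hdigit p X
  · intro xy hxy
    rw [mem_product] at hxy
    exact Prod.ext (digit_combine hxy.1 _) (hdigit_combine hxy.1 _)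
  · intro X _; simp only [digit_add_mul_hdigit]

/-- `tp` over all tuples is the `k`-th power of `f`: `∑_{X ∈ I^k} e(α·s(X)) = f(α)^k`. [folklore] -/
theorem tp_tuples_psv (n k : ℕ) (I : Finset ℤ) (α : Fin n → ℝ) :
    tp (tuples k I) (psv n) α = (tp I (nu n) α) ^ k := by
  have h := prod_tp_eq (n := n) (m := k) (fun _ => I) (fun _ => nu n) α
  rw [prod_const, card_univ, Fintype.card_fin] at h
  rw [h]
  unfold tuples
  congr 1
  funext X
  exact psv_eq_sum_nu n X

/-- `(S_x)^k` is the trigonometric polynomial of the tuples `y ∈ [0,P₁)^k` with frequencies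
`s(x + py)`. [folklore] -/
theorem Sx_pow (n p P₁ k : ℕ) (x : ℤ) (α : Fin n → ℝ) :
    Sx n p P₁ x α ^ k = tp (tuples k (Yset P₁)) (fun y => psv n (fun l => x + p * y l)) α := by
  have h := prod_tp_eq (n := n) (m := k) (fun _ => Yset P₁) (fun _ => fun y => nu n (x + p * y)) α
  rw [prod_const, card_univ, Fintype.card_fin] at h
  unfold Sx
  rw [h]
  unfold tuples
  congr 1
  funext y
  exact (psv_eq_sum_nu n _).symm

/-- The affine change of variables `y ↦ x + py` does not change the system:
`s(x + py) = s(x + py')` iff `s(y) = s(y')` (`p ≠ 0`). [cite: Ivic1985, proof of Lemma 6.2] -/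
theorem psv_affine_iff {n k : ℕ} {p : ℤ} (hp : p ≠ 0) (x : ℤ) (y y' : Fin k → ℤ) :
    psv n (fun l => x + p * y l) = psv n (fun l => x + p * y' l) ↔ psv n y = psv n y' := by
  constructor
  · intro h
    have h1 := psv_add_const_eq h (-x)
    simp only [add_neg_cancel_comm] at h1
    funext j
    have := congr_fun h1 j
    rw [psv_const_mul, psv_const_mul] at this
    exact mul_left_cancel₀ (pow_ne_zero _ hp) this
  · intro h
    have h1 : psv n (fun l => p * y l) = psv n (fun l => p * y' l) := by
      funext j; rw [psv_const_mul, psv_const_mul, h]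
    have h2 := psv_add_const_eq h1 x
    convert h2 using 2 <;> funext l <;> ring

/-- **`∫_{[0,1]^n} |S_x(α)|^{2k} dα = J_{k,n}([0, P₁))`** for every `x` (and every `p ≠ 0`).
[cite: Ivic1985, proof of Lemma 6.2] -/
theorem integral_norm_Sx_pow {n p P₁ : ℕ} (hp : 0 < p) (k : ℕ) (x : ℤ) :
    ∫ α in box n, ‖Sx n p P₁ x α‖ ^ (2 * k) = (J n k (Yset P₁) : ℝ) := by
  have hp' : (p : ℤ) ≠ 0 := by exact_mod_cast hp.ne'
  rw [show (fun α => ‖Sx n p P₁ x α‖ ^ (2 * k)) = fun α => ‖(Sx n p P₁ x α) ^ k‖ ^ 2 by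
    funext α; rw [norm_pow, ← pow_mul, mul_comm]]
  simp_rw [Sx_pow]
  rw [integral_norm_sq_tp]
  unfold J Jc
  congr 2
  refine filter_congr fun yy _ => ?_
  rw [add_zero]
  exact psv_affine_iff hp' x _ _

/-! ### Degenerate digit patterns and the second class -/

/-- A digit pattern `x ∈ [1,p]^k` is *degenerate* if it takes fewer than `n` distinct values.
[cite: Ivic1985, p. 149 ("the second class")] -/
def IsDegPat (n : ℕ) {k : ℕ} (x : Fin k → ℤ) : Prop := (univ.image x).card < n

/-- Decidability of the predicate (by unfolding to a finite conjunction). [folklore] -/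
instance (n k : ℕ) : DecidablePred (IsDegPat n (k := k)) := fun _ => by
  unfold IsDegPat; infer_instance

/-- The degenerate patterns in `[1,p]^k`. [folklore] -/
def degPat (n k p : ℕ) : Finset (Fin k → ℤ) := (tuples k (Dig p)).filter (IsDegPat n)

/-- **At most `p^{n-1} n^k` degenerate patterns** ("at most `n − 1` distinct numbers … so there
are at most `n^k p^{n-1}` choices"). [cite: Ivic1985, p. 151] -/
theorem card_degPat_le {n k p : ℕ} (hn : 1 ≤ n) (hnp : n ≤ p) :
    (degPat n k p).card ≤ p ^ (n - 1) * n ^ k := by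
  classical
  -- every degenerate pattern takes values in some `V ⊆ [1,p]` with `#V = n - 1`
  have hcover : degPat n k p ⊆ ((Dig p).powersetCard (n - 1)).biUnion (fun V => tuples k V) := by
    intro x hx
    rw [degPat, mem_filter, mem_tuples] at hx
    have hsub : univ.image x ⊆ Dig p := by
      intro a ha; obtain ⟨i, _, rfl⟩ := mem_image.1 ha; exact hx.1 i
    have hcard : (univ.image x).card ≤ n - 1 := by have := hx.2; unfold IsDegPat at this; omega
    obtain ⟨V, hxV, hVD, hV⟩ := exists_subsuperset_card_eq hsub hcard (by rw [card_Dig]; omega)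
    rw [mem_biUnion]
    refine ⟨V, mem_powersetCard.2 ⟨hVD, hV⟩, mem_tuples.2 fun i => hxV (mem_image.2 ⟨i, mem_univ _, rfl⟩)⟩
  refine (card_le_card hcover).trans ((card_biUnion_le).trans ?_)
  calc ∑ V ∈ (Dig p).powersetCard (n - 1), (tuples k V).card
      = ∑ V ∈ (Dig p).powersetCard (n - 1), (n - 1) ^ k := by
        refine sum_congr rfl fun V hV => ?_
        rw [card_tuples, (mem_powersetCard.1 hV).2]
    _ ≤ p ^ (n - 1) * n ^ k := by
        rw [sum_const, card_powersetCard, card_Dig, smul_eq_mul]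
        exact Nat.mul_le_mul (Nat.choose_le_pow _ _) (Nat.pow_le_pow_left (Nat.sub_le _ _) _)

/-- AM–GM in the form used for the second class: for nonnegative reals `c_i, d_i` (`i < k`,
`k ≥ 1`), `(∏ c_i)(∏ d_i) ≤ (∑ c_i^{2k} + ∑ d_i^{2k})/(2k)`. [folklore] -/
theorem prod_mul_prod_le_sum_pow {k : ℕ} (hk : 1 ≤ k) (c d : Fin k → ℝ) (hc : ∀ i, 0 ≤ c i)
    (hd : ∀ i, 0 ≤ d i) :
    (∏ i, c i) * (∏ i, d i) ≤ ((∑ i, c i ^ (2 * k)) + ∑ i, d i ^ (2 * k)) / (2 * k) := by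
  have h2k : (2 * k : ℝ) ≠ 0 := by positivity
  have h2k' : (2 * k : ℕ) ≠ 0 := by omega
  set z : Fin k ⊕ Fin k → ℝ := Sum.elim c d with hz
  have hz0 : ∀ l, 0 ≤ z l := fun l => by rcases l with i | i <;> simp [hz, hc, hd]
  have hAMGM := Real.geom_mean_le_arith_mean_weighted (univ : Finset (Fin k ⊕ Fin k))
    (fun _ => 1 / (2 * k)) (fun l => z l ^ (2 * k)) (fun _ _ => by positivity)
    (by rw [sum_const, card_univ, Fintype.card_sum, Fintype.card_fin, nsmul_eq_mul]; push_cast; field_simp;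
          norm_num)
    (fun l _ => pow_nonneg (hz0 l) _)
  have hL : ∏ l : Fin k ⊕ Fin k, (z l ^ (2 * k)) ^ (1 / (2 * k) : ℝ) = (∏ i, c i) * ∏ i, d i := by
    rw [Fintype.prod_sum_type]
    congr 1 <;> refine prod_congr rfl fun i _ => ?_ <;>
      rw [one_div, show ((2 : ℝ) * k) = ((2 * k : ℕ) : ℝ) by push_cast; ring,
        Real.pow_rpow_inv_natCast (hz0 _) h2k'] <;> simp [hz]
  have hR : ∑ l : Fin k ⊕ Fin k, 1 / (2 * k : ℝ) * z l ^ (2 * k) =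
      ((∑ i, c i ^ (2 * k)) + ∑ i, d i ^ (2 * k)) / (2 * k) := by
    rw [← mul_sum, Fintype.sum_sum_type]
    simp only [hz, Sum.elim_inl, Sum.elim_inr]
    field_simp
  rw [← hL, ← hR]
  exact hAMGM

/-- The trigonometric polynomial of the degenerate tuples, in digit coordinates:
`∑_{X ∈ [1,pP₁]^k, deg} e(α·s(X)) = ∑_{x ∈ degPat} ∏_i S_{x_i}(α)`. [cite: Ivic1985, p. 151] -/
theorem tp_deg_eq {n k p P₁ : ℕ} (hp : 0 < p) (α : Fin n → ℝ) :
    tp ((tuples k (IQ p P₁)).filter (fun X => IsDegPat n (fun i => digit p (X i)))) (psv n) α =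
      ∑ x ∈ degPat n k p, ∏ i, Sx n p P₁ (x i) α := by
  unfold tp
  rw [sum_tuples_IQ_eq hp (fun X => E (psv n X) α) (IsDegPat n), sum_product]
  refine sum_congr rfl fun x _ => ?_
  unfold Sx tp tuples
  rw [prod_univ_sum]
  refine sum_congr rfl fun y _ => ?_
  rw [psv_eq_sum_nu, E_sum]

/-- **The second class** (Ivić's bound for `J₂`, p. 151): the number of solutions `(X, Y)` of
`s(X) = s(Y)` in `[1, pP₁]^k × [1, pP₁]^k` whose digit pattern `(x_i)` of `X` is degenerate is at
most `#degPat · p^k · J_{k,n}([0, P₁))`. [cite: Ivic1985, Lemma 6.2 (proof, the class `J₂`)] -/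
theorem card_sol_deg_le {n k p P₁ : ℕ} (hp : 0 < p) (hk : 1 ≤ k) :
    (((tuples k (IQ p P₁) ×ˢ tuples k (IQ p P₁)).filter (fun XY => psv n XY.1 = psv n XY.2 + 0 ∧
        IsDegPat n (fun i => digit p (XY.1 i)))).card : ℝ)
      ≤ (degPat n k p).card * (p : ℝ) ^ k * J n k (Yset P₁) := by
  classical
  set Deg := (tuples k (IQ p P₁)).filter (fun X => IsDegPat n (fun i => digit p (X i))) with hDeg
  set All := tuples k (IQ p P₁) with hAll
  -- the count as an integral
  have hcount : ((((tuples k (IQ p P₁) ×ˢ tuples k (IQ p P₁)).filter (fun XY =>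
      psv n XY.1 = psv n XY.2 + 0 ∧ IsDegPat n (fun i => digit p (XY.1 i)))).card : ℝ) : ℂ)
      = ∫ α in box n, tp Deg (psv n) α * conj (tp All (psv n) α) := by
    rw [integral_tp_mul_conj_tp]
    norm_cast
    congr 1
    ext XY
    simp only [hDeg, hAll, mem_filter, mem_product, add_zero]
    tauto
  -- pointwise bound of the integrand
  set a : ℤ → (Fin n → ℝ) → ℝ := fun x α => ‖Sx n p P₁ x α‖ with ha
  have ha0 : ∀ x α, 0 ≤ a x α := fun x α => norm_nonneg _
  set G : (Fin n → ℝ) → ℝ := fun α => ∑ x ∈ degPat n k p, ∑ x' ∈ tuples k (Dig p),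
      ((∑ i, a (x i) α ^ (2 * k)) + ∑ i, a (x' i) α ^ (2 * k)) / (2 * k) with hG
  have hpt : ∀ α, ‖tp Deg (psv n) α * conj (tp All (psv n) α)‖ ≤ G α := by
    intro α
    rw [norm_mul, Complex.norm_conj, hAll, tp_tuples_psv, norm_pow, ← fQ, fQ_eq_sum_Sx hp,
      hDeg, tp_deg_eq hp]
    have h1 : ‖∑ x ∈ degPat n k p, ∏ i, Sx n p P₁ (x i) α‖ ≤ ∑ x ∈ degPat n k p, ∏ i, a (x i) α := by
      refine (norm_sum_le _ _).trans (sum_le_sum fun x _ => ?_)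
      rw [norm_prod]
    have h2 : ‖∑ x ∈ Dig p, Sx n p P₁ x α‖ ^ k ≤ ∑ x' ∈ tuples k (Dig p), ∏ i, a (x' i) α := by
      calc ‖∑ x ∈ Dig p, Sx n p P₁ x α‖ ^ k ≤ (∑ x ∈ Dig p, a x α) ^ k :=
            pow_le_pow_left₀ (norm_nonneg _) (norm_sum_le _ _) _
        _ = ∑ x' ∈ tuples k (Dig p), ∏ i, a (x' i) α := by
            rw [← Fin.prod_const k (∑ x ∈ Dig p, a x α), prod_univ_sum]; rfl
    calc ‖∑ x ∈ degPat n k p, ∏ i, Sx n p P₁ (x i) α‖ * ‖∑ x ∈ Dig p, Sx n p P₁ x α‖ ^ k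
        ≤ (∑ x ∈ degPat n k p, ∏ i, a (x i) α) * ∑ x' ∈ tuples k (Dig p), ∏ i, a (x' i) α :=
          mul_le_mul h1 h2 (by positivity) (sum_nonneg fun _ _ => prod_nonneg fun _ _ => ha0 _ _)
      _ = ∑ x ∈ degPat n k p, ∑ x' ∈ tuples k (Dig p), (∏ i, a (x i) α) * ∏ i, a (x' i) α := by
          rw [sum_mul_sum]
      _ ≤ G α := sum_le_sum fun x _ => sum_le_sum fun x' _ =>
          prod_mul_prod_le_sum_pow hk _ _ (fun i => ha0 _ _) (fun i => ha0 _ _)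
  -- integrate
  have hGint : ∫ α in box n, G α = (degPat n k p).card * (p : ℝ) ^ k * J n k (Yset P₁) := by
    have hI : ∀ x : ℤ, ∫ α in box n, a x α ^ (2 * k) = (J n k (Yset P₁) : ℝ) :=
      fun x => integral_norm_Sx_pow hp k x
    have hint : ∀ x : ℤ, Integrable (fun α => a x α ^ (2 * k)) (volume.restrict (box n)) :=
      fun x => integrableOn_box_of_continuous_real ((continuous_Sx n p P₁ x).norm.pow _)
    have hterm : ∀ (x x' : Fin k → ℤ), ∫ α in box n,
        ((∑ i, a (x i) α ^ (2 * k)) + ∑ i, a (x' i) α ^ (2 * k)) / (2 * k) = (J n k (Yset P₁) : ℝ) := by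
      intro x x'
      rw [integral_div, integral_add (integrable_finsetSum _ fun i _ => hint _)
        (integrable_finsetSum _ fun i _ => hint _), integral_finsetSum _ (fun i _ => hint _),
        integral_finsetSum _ (fun i _ => hint _)]
      simp_rw [hI]
      simp only [sum_const, card_univ, Fintype.card_fin, nsmul_eq_mul]
      have : (k : ℝ) ≠ 0 := by exact_mod_cast (show k ≠ 0 by omega)
      field_simp
      ring
    have hint2 : ∀ (x x' : Fin k → ℤ), Integrable (fun α =>
        ((∑ i, a (x i) α ^ (2 * k)) + ∑ i, a (x' i) α ^ (2 * k)) / (2 * k)) (volume.restrict (box n)) :=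
      fun x x' => ((integrable_finsetSum _ fun i _ => hint (x i)).add
        (integrable_finsetSum _ fun i _ => hint (x' i))).div_const _
    rw [hG]
    rw [integral_finsetSum _ (fun x _ => integrable_finsetSum _ fun x' _ => hint2 x x')]
    simp_rw [integral_finsetSum _ (fun x' _ => hint2 _ x'), hterm]
    rw [sum_const, sum_const, card_tuples, card_Dig, nsmul_eq_mul, nsmul_eq_mul]
    push_cast
    ring
  -- assemble
  have hGi : Integrable G (volume.restrict (box n)) := by
    refine integrableOn_box_of_continuous_real ?_
    unfold G
    refine continuous_finsetSum _ fun x _ => continuous_finsetSum _ fun x' _ => Continuous.div_const ?_ _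
    exact (continuous_finsetSum _ fun i _ => ((continuous_Sx n p P₁ _).norm.pow _)).add
      (continuous_finsetSum _ fun i _ => ((continuous_Sx n p P₁ _).norm.pow _))
  have key : ((((tuples k (IQ p P₁) ×ˢ tuples k (IQ p P₁)).filter (fun XY =>
      psv n XY.1 = psv n XY.2 + 0 ∧ IsDegPat n (fun i => digit p (XY.1 i)))).card : ℝ))
      ≤ ∫ α in box n, G α := by
    have h1 := congrArg norm hcount
    rw [Complex.norm_real, Real.norm_eq_abs, abs_of_nonneg (Nat.cast_nonneg _)] at h1
    rw [h1]
    refine (norm_integral_le_integral_norm _).trans ?_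
    refine integral_mono_of_nonneg (Filter.Eventually.of_forall fun α => norm_nonneg _) hGi
      (Filter.Eventually.of_forall hpt)
  rw [hGint] at key
  exact key

end VMV
end Literature.NumberTheory.LFunctions
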